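import Summits.BirchSwinnertonDyer.BirchSwinnertonDyer.Theorems.PrintCf2SplitBadTwoGeneratorPairSupply

/-!
# B12 / O1 (generator pair at `p = 2`) — POINTER, rev 2: this brick is ALREADY IN THE TREE (p654108, width seat -w4 g7,
# `Theorems/PrintCf2SplitBadTwoGeneratorPairSupply.lean`); rev 1 of this workfile (commit 38c7021800dd) re-proved it unawares and is WITHDRAWN
# as a credit claim. Cite instead:
# * `PrintCf2.GeneratorPairSupply.exists_isTopGeneratorPair_two (hK : IsImaginaryQuadratic K)` — conjunct 11 of S1ⁿ (`stub_nativeFrame_two`);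
# * `PrintCf2.GeneratorPairSupply.factorsThroughPair_of_forall_character_of_isImaginaryQuadratic` — the through-pair reduction used for
#   conjunct 18 (a character trivial on the kernel of every `Γ_K →ₜ* ℤ₂` factors through ANY generator pair);
# * `PrintCf2.GeneratorPairSupply.pairKer_eq_iInf_of_isImaginaryQuadratic` — the kernel clause.
# The two `example`s below check that the tree theorems give exactly the forms the native line consumes. Ideator bsd-idea-7 g10 (publish-only).
# BSD is not proved by any of this.
-/

set_option autoImplicit false

noncomputable section

open NumberField Field
open Literature.NumberTheory.GaloisRepresentations Literature.NumberTheory.EllipticCurves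
open Summit.BirchSwinnertonDyer.BirchSwinnertonDyer.Theorems.PrintCf2

example {K : Type} [Field K] [NumberField K] (hK : IsImaginaryQuadratic K) :
    ∃ (κ₁ κ₂ : ZpExtension K 2) (γ₁ γ₂ : absoluteGaloisGroup K), ZpExtension.IsTopGeneratorPair κ₁ κ₂ γ₁ γ₂ :=
  GeneratorPairSupply.exists_isTopGeneratorPair_two hK

example {K : Type} [Field K] [NumberField K] (hK : IsImaginaryQuadratic K)
    {κ₁ κ₂ : ZpExtension K 2} {γ₁ γ₂ : absoluteGaloisGroup K} (h : ZpExtension.IsTopGeneratorPair κ₁ κ₂ γ₁ γ₂)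
    {r : FramedGaloisRep K (PadicAlgCl 2) 1}
    (hr : ∀ σ : absoluteGaloisGroup K, (∀ f : absoluteGaloisGroup K →ₜ* Multiplicative ℤ_[2], f σ = 1) → r σ = 1) :
    FactorsThroughPair κ₁ κ₂ r :=
  GeneratorPairSupply.factorsThroughPair_of_forall_character_of_isImaginaryQuadratic hK h hr

end
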